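import Literature.Computability.Complexity.NPBoundedQuantifiers
import Literature.Computability.Complexity.StringEquality
import Literature.Computability.Complexity.KarpLipton
import Literature.Computability.Complexity.PromiseCookReductions
import HarnessLib

/-!
# A Cook reduction to a promise problem with `NP`-certified answers lands in `NP ∩ coNP` (Aharonov–Regev 2005, Lemma B.1)

Trunk `Literature/Computability/Complexity`, companion of `PromiseCookReductions.lean` (Cook
reductions among promise problems, Goldreich's Def. 3 in the functional formulation: the oracle
machine must be correct against EVERY total function `σ` conforming with the target problem) and of
`PRelHierarchy.lean` (Stockmeyer's "guess the oracle answers" calculus: free-running transcripts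
`PRelSigma.trans`, one-bit transcripts `bitsTrans`, the step machine of an oracle algorithm as an
`FP` string map `stepCode_comp_mem_FP`).

**The printed result** (D. Aharonov, O. Regev, *Lattice problems in NP ∩ coNP*, J. ACM 52 (2005);
preprint p. 15, Lemma B.1): "Let `Π = (Π_YES, Π_NO)` be a promise problem and let `Π_MAYBE` denote
all instances outside `Π_YES ∪ Π_NO`. Assume that `Π` is in coNP and that the (non-promise) problem
`Π' = (Π_YES ∪ Π_MAYBE, Π_NO)` is in NP. Then, if `Π` is NP-hard under Cook reductions then
`NP ⊆ coNP` and the polynomial hierarchy collapses." Printed proof: the coNP-verifier for SAT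
"simulates `T`; for each query `xᵢ` that `T` performs, the verifier reads the pair corresponding to
`xᵢ` in the witness. If the pair is of the form `(YES, w)` then the verifier checks that `V₂(xᵢ, w)`
accepts and then returns YES to `T`. Similarly, if the pair is of the form `(NO, w)` then the verifier
checks that `V₁(xᵢ, w)` accepts and then returns NO to `T` … for each query `xᵢ ∈ Π_NO` the witness
must include a pair of the form `(NO, w)` because otherwise `V₂` would reject. Similarly, for each
query `xᵢ ∈ Π_YES` the witness must include a pair of the form `(YES, w)` … `T` receives the correct
answers for all of its queries inside `Π_NO ∪ Π_YES` and must therefore output the correct answer"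
("a similar proof has already appeared before (see [25, 9, 13])", i.e. Micciancio–Goldwasser 2002,
Cai–Nerurkar, Goldreich–Goldwasser).

**What is proved here.**

* `Literature.Computability.Complexity.mem_NP_of_run_certified` — the abstract core. Let
  `A, B ∈ NP` with `A ∪ B = {0,1}*` ("every string has a certifiable answer": answering `1` on `y`
  is certified by `y ∈ A`, answering `0` by `y ∈ B`), and let the polynomial-time oracle algorithm
  `M` with round budget `q` output the same bit `b x` against EVERY oracle all of whose answers are
  certified (`PromiseCookNP.Certified A B`). Then `{x | b x = v} ∈ NP` for both bits `v`.
* `Literature.Computability.Complexity.PromiseProblem.mem_NP_inter_coNP_of_cookReducible` —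
  Lemma B.1 for one language: if `L` (trivial promise) Cook-reduces to `Q`
  (`PromiseProblem.CookReducible`), `Q ∈ PromiseCoNP` (a `coNP` language `L'` separates `Q`; this is
  `V₁`) and the language `(Q.no)ᶜ = Π_YES ∪ Π_MAYBE` is in `NP` (`V₂`), then `L ∈ NP ∩ coNP`: take
  `A := (Q.no)ᶜ`, `B := L'ᶜ`; every certified oracle solves `Q` (`PromiseProblem.SolvedBy`), so the
  reduction outputs `[x ∈ L]` against it.

The discharge `Literature.Barriers.PneNP.AharonovRegev2005_lemmaB1_holds` of the barrier
catalogue's named fact is the one-line consequence (file `Literature/Barriers/PneNP/LatticeGapCoNPProofs.lean`).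

**The verifier, formally** (certificate calculus, no machine is programmed). The NP witness for
`b x = v` is the string `as` of guessed one-bit answers; the NP-certificates of the individual
answers are absorbed by the closure of `NP` under polynomially bounded `∀` (`NPBounded.ballLang_mem_NP`,
which concatenates them). The witness language `PromiseCookNP.certLang` is the intersection of
(W1, `P`) `|as| < q|x|` and the step of `M` after the answers `as` outputs `v`;
(W2, `P`) for every round `j < |as|` the step after the first `j` answers is a query (a `ballLang`
loop); (W3, `NP`) for every `j < |as|`, if `as_j = 1` then the query `y_j` of round `j` is in `A`,
else it is in `B` (a `ballLang` loop over a `P`-guarded case split of two `FP`-preimages of `A`, `B`);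
and — the one point where the functional formulation of Cook reductions needs more than the printed
proof, which lets the answers on `Π_MAYBE` depend on the history — (W4, `P`) CONSISTENCY: for all
`j, j' < |as|`, equal queries `y_j = y_{j'}` carry equal guessed bits (a double `ballLang` loop over the
string-equality test `setOf_apply_eq_apply_mem_P` of `StringEquality.lean`). Then
`{x | b x = v} = {x | ∃ as, |as| ≤ q|x| ∧ ⟨x, as⟩ ∈ certLang} ∈ ∃ᵖ·NP = NP`
(`KarpLipton.polyExists_polyExists_subset`). Soundness (`PromiseCookNP.eq_of_mem_certLang`): by (W4) the
guessed bits define a genuine oracle `PromiseCookNP.guessOracle` (the guessed bit on the queried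
strings, `[y ∈ A]` elsewhere), which is certified by (W3); by (W2) and the round induction
`PromiseCookNP.trans_eq_bitsTrans_take_of_answers` the run of `M` against it follows the guessed
answers and by (W1) outputs `v`; by hypothesis that output is `b x`. Completeness
(`PromiseCookNP.mem_certLang_answerBits`): the true answer bits of the run against the certified
oracle `Oracle.ofLanguage A` (`PRelSigma.answerBits`).

## References

* D. Aharonov, O. Regev, *Lattice problems in NP ∩ coNP*, J. ACM 52 (2005) 749–765 (FOCS 2004),
  Appendix B, Lemma B.1 and its proof (preprint p. 15) [AharonovRegev2005].
* O. Goldreich, *On promise problems: a survey*, LNCS 3895 (2006), §1.2 Def. 3 (Cook reductions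
  among promise problems, functions `σ` conforming with `Π'`) [Goldreich2006].
* L. J. Stockmeyer, *The polynomial-time hierarchy*, Theoret. Comput. Sci. 3 (1976), proof of
  Thm. 3.1 ("guess the sequence of oracle answers and verify") [Stockmeyer1976].
* S. Arora, B. Barak, *Computational Complexity: A Modern Approach*, CUP 2009, §3.4 (oracle
  machines), Def. 2.1 and Thm. 2.8 (certificates, closure of `NP`) [AroraBarak2009].
-/

noncomputable section

namespace Literature.Computability.Complexity

open _root_.Computability Polynomial PRelSigma

namespace PromiseCookNP

/-! ### Oracles with certified answers -/

/-- `Certified A B O`: every answer of the oracle `O` is a certified bit — either `[true]` on a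
string of `A`, or `[false]` on a string of `B` (Aharonov–Regev: the pairs `(YES, w₂)` with `V₂`
accepting, `(NO, w₁)` with `V₁` accepting). [cite: AharonovRegev2005, Lemma B.1 (proof, p. 15)] -/
def Certified (A B : Language Bool) (O : Oracle) : Prop :=
  ∀ y : List Bool, (O y = [true] ∧ y ∈ A) ∨ (O y = [false] ∧ y ∈ B)

/-- The oracle of the language `A` is certified as soon as every string outside `A` lies in `B`.
[cite: AharonovRegev2005, Lemma B.1 (proof, p. 15)] -/
theorem certified_ofLanguage {A B : Language Bool} (hAB : ∀ y, y ∉ A → y ∈ B) :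
    Certified A B (Oracle.ofLanguage A) := fun y => by
  by_cases hy : y ∈ A
  · exact Or.inl ⟨by rw [ofLanguage_eq_singleton, (Set.mem_iff_boolIndicator _ _).1 hy], hy⟩
  · exact Or.inr ⟨by rw [ofLanguage_eq_singleton, (Set.notMem_iff_boolIndicator _ _).1 hy], hAB y hy⟩

/-! ### Transcripts along guessed answers, for an arbitrary oracle -/

section Transcripts

variable {β : Type}

/-- **Guessed answers drive the run (arbitrary oracle).** If for every `i < m` the step after the
first `i` guessed answers is a query answered by `O` with the bit `as_i`, then the free-running
transcript of the first `i ≤ m` rounds is the first `i` guessed answers (`PRelSigma.trans_eq_bitsTrans_take`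
is the case of a language oracle). [cite: Stockmeyer1976, Thm. 3.1 (proof)] -/
theorem trans_eq_bitsTrans_take_of_answers (M : OracleAlg β) (O : Oracle) (x : List Bool)
    (as : List Bool) (m : ℕ) (hm : m ≤ as.length)
    (hvalid : ∀ i < m, ∃ y, M.step x (bitsTrans (as.take i)) = Sum.inl y ∧
      O y = [as.getD i false]) :
    ∀ i ≤ m, trans M O x i = bitsTrans (as.take i)
  | 0, _ => by simp
  | i + 1, hi => by
    have ih := trans_eq_bitsTrans_take_of_answers M O x as m hm hvalid i (by omega)
    obtain ⟨y, hy, hO⟩ := hvalid i (by omega)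
    rw [trans_succ, ih, qryOf_eq_of_step_eq hy, hO, take_succ_eq_getD as (by omega),
      bitsTrans_append, bitsTrans_singleton]

end Transcripts

/-- Reading a step code: it is `1 v` iff the step outputs `v` (`PRelSigma.stepCode_output_true_iff`
for both bits). [folklore] -/
theorem stepCode_output_iff (r : List Bool ⊕ Bool) (v : Bool) :
    (stepCode r ∈ HeadIs true ∧ (stepCode r).tail ∈ HeadIs v) ↔ r = Sum.inr v := by
  cases r with
  | inl y => simp
  | inr b => cases b <;> cases v <;> simp

/-- The answer bit of round `j` inside the range, read off the suffix. [folklore] -/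
theorem head?_drop_eq_some_getD (as : List Bool) {j : ℕ} (hj : j < as.length) :
    (as.drop j).head? = some (as.getD j false) := by
  rw [List.head?_drop, List.getD_eq_getElem?_getD, List.getElem?_eq_getElem hj]
  rfl

/-- The query of round `j` along the guessed answers `as` (the tail of the step code; junk `[b]`
if the step outputs `b`). [folklore] -/
def qryAt (M : OracleAlg Bool) (x as : List Bool) (j : ℕ) : List Bool :=
  (stepCode (M.step x (bitsTrans (as.take j)))).tail

/-- If round `j` is the query `y` then `qryAt = y`. [folklore] -/
theorem qryAt_eq_of_step_eq {M : OracleAlg Bool} {x as : List Bool} {j : ℕ} {y : List Bool}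
    (h : M.step x (bitsTrans (as.take j)) = Sum.inl y) : qryAt M x as j = y := by
  simp [qryAt, h]

/-! ### Accessors and the step map on `⟨⟨x, as⟩, 1ʲ⟩` and `⟨⟨⟨x, as⟩, 1ʲ⟩, 1ʲ'⟩` -/

section Access

/-- On `v = ⟨⟨x, as⟩, z⟩`: the prefix `as ↾ |z|`. [folklore] -/
def pre1 : List Bool → List Bool := sndP ∘ truncSndFn X ∘ pairFn sndP asFn

/-- On `v = ⟨⟨x, as⟩, z⟩`: the suffix `as.drop |z|`. [folklore] -/
def suf1 : List Bool → List Bool := sndP ∘ dropSndFn X ∘ pairFn sndP asFn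

/-- On `u = ⟨⟨⟨x, as⟩, z⟩, z'⟩`: the prefix `as ↾ |z'|`. [folklore] -/
def preK : List Bool → List Bool := sndP ∘ truncSndFn X ∘ pairFn sndP (asFn ∘ fstP)

/-- On `u = ⟨⟨⟨x, as⟩, z⟩, z'⟩`: the suffix `as.drop |z'|`. [folklore] -/
def sufK : List Bool → List Bool := sndP ∘ dropSndFn X ∘ pairFn sndP (asFn ∘ fstP)

/-- `pre1 ∈ FP`. [folklore] -/
theorem pre1_mem_FP : pre1 ∈ FP :=
  comp_mem_FP sndP_mem_FP (comp_mem_FP (truncSndFn_mem_FP X) (pairFn_mem_FP sndP_mem_FP asFn_mem_FP))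

/-- `suf1 ∈ FP`. [folklore] -/
theorem suf1_mem_FP : suf1 ∈ FP :=
  comp_mem_FP sndP_mem_FP (comp_mem_FP (dropSndFn_mem_FP X) (pairFn_mem_FP sndP_mem_FP asFn_mem_FP))

/-- `preK ∈ FP`. [folklore] -/
theorem preK_mem_FP : preK ∈ FP :=
  comp_mem_FP sndP_mem_FP (comp_mem_FP (truncSndFn_mem_FP X)
    (pairFn_mem_FP sndP_mem_FP (comp_mem_FP asFn_mem_FP fstP_mem_FP)))

/-- `sufK ∈ FP`. [folklore] -/
theorem sufK_mem_FP : sufK ∈ FP :=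
  comp_mem_FP sndP_mem_FP (comp_mem_FP (dropSndFn_mem_FP X)
    (pairFn_mem_FP sndP_mem_FP (comp_mem_FP asFn_mem_FP fstP_mem_FP)))

variable (x as z z' : List Bool)

/-- `pre1` reads `as ↾ |z|`. [folklore] -/
@[simp] theorem pre1_apply : pre1 (boolPair (boolPair x as) z) = as.take z.length := by
  simp [pre1, truncSndFn_boolPair]

/-- `suf1` reads `as.drop |z|`. [folklore] -/
@[simp] theorem suf1_apply : suf1 (boolPair (boolPair x as) z) = as.drop z.length := by
  simp [suf1, dropSndFn_boolPair]

/-- `preK` reads `as ↾ |z'|`. [folklore] -/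
@[simp] theorem preK_apply : preK (boolPair (boolPair (boolPair x as) z) z') = as.take z'.length := by
  simp [preK, truncSndFn_boolPair]

/-- `sufK` reads `as.drop |z'|`. [folklore] -/
@[simp] theorem sufK_apply : sufK (boolPair (boolPair (boolPair x as) z) z') = as.drop z'.length := by
  simp [sufK, dropSndFn_boolPair]

variable (M : OracleAlg Bool)

/-- The code of the step of `M` at round `|z|` along the guessed answers, on `⟨⟨x, as⟩, z⟩`. [folklore] -/
def step1 (v : List Bool) : List Bool :=
  stepCode (M.step (xFn v) (bitsTrans (pre1 v)))

/-- The code of the step of `M` at round `|z'|`, on `⟨⟨⟨x, as⟩, z⟩, z'⟩`. [folklore] -/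
def stepK (u : List Bool) : List Bool :=
  stepCode (M.step ((xFn ∘ fstP) u) (bitsTrans (preK u)))

/-- The code of the step of `M` after all guessed answers, on `⟨x, as⟩`. [folklore] -/
def last0 (w : List Bool) : List Bool :=
  stepCode (M.step (fstP w) (bitsTrans (sndP w)))

variable {M}

/-- `step1 M ∈ FP` for polynomial-time `M`. [folklore] -/
theorem step1_mem_FP (hM : M.IsPolyTime encodingBoolBool) : step1 M ∈ FP :=
  stepCode_comp_mem_FP M hM xFn_mem_FP pre1_mem_FP

/-- `stepK M ∈ FP` for polynomial-time `M`. [folklore] -/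
theorem stepK_mem_FP (hM : M.IsPolyTime encodingBoolBool) : stepK M ∈ FP :=
  stepCode_comp_mem_FP M hM (comp_mem_FP xFn_mem_FP fstP_mem_FP) preK_mem_FP

/-- `last0 M ∈ FP` for polynomial-time `M`. [folklore] -/
theorem last0_mem_FP (hM : M.IsPolyTime encodingBoolBool) : last0 M ∈ FP :=
  stepCode_comp_mem_FP M hM fstP_mem_FP sndP_mem_FP

variable (M)

/-- `step1` on `⟨⟨x, as⟩, z⟩` is the code of the step at round `|z|`. [folklore] -/
@[simp] theorem step1_apply :
    step1 M (boolPair (boolPair x as) z) = stepCode (M.step x (bitsTrans (as.take z.length))) := by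
  simp [step1]

/-- `stepK` on `⟨⟨⟨x, as⟩, z⟩, z'⟩` is the code of the step at round `|z'|`. [folklore] -/
@[simp] theorem stepK_apply : stepK M (boolPair (boolPair (boolPair x as) z) z') =
    stepCode (M.step x (bitsTrans (as.take z'.length))) := by
  simp [stepK]

/-- `last0` on `⟨x, as⟩` is the code of the step after all of `as`. [folklore] -/
@[simp] theorem last0_apply : last0 M (boolPair x as) = stepCode (M.step x (bitsTrans as)) := by
  simp [last0]

end Access

/-! ### The witness language -/

section Languages

variable (M : OracleAlg Bool) (A B : Language Bool) (q : Polynomial ℕ)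

/-- On `⟨⟨x, as⟩, 1ʲ⟩`: `j < |as|`. [folklore] -/
def Gj1 : Language Bool := pairFn asFn sndP ⁻¹' LenLt X
/-- On `⟨⟨x, as⟩, 1ʲ⟩`: round `j` is a query. [folklore] -/
def IQ1 : Language Bool := step1 M ⁻¹' HeadIs false
/-- On `⟨⟨x, as⟩, 1ʲ⟩`: the guessed bit `as_j` is `1`. [folklore] -/
def BT1 : Language Bool := suf1 ⁻¹' HeadIs true
/-- On `⟨⟨x, as⟩, 1ʲ⟩`: the query of round `j` lies in `C`. [folklore] -/
def QIn (C : Language Bool) : Language Bool := (List.tail ∘ step1 M) ⁻¹' C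
/-- Body of (W2): if `j < |as|` then round `j` is a query. [folklore] -/
def bodyQ : Language Bool := (Gj1)ᶜ ⊔ IQ1 M
/-- Body of (W3): if `j < |as|` then (`as_j = 1 ⇒ y_j ∈ A`, else `y_j ∈ B`).
[cite: AharonovRegev2005, Lemma B.1 (proof, p. 15)] -/
def bodyC : Language Bool := (Gj1)ᶜ ⊔ caseSplit BT1 (QIn M A) (QIn M B)
/-- On `⟨⟨⟨x, as⟩, 1ʲ⟩, 1ʲ'⟩`: `j < |as|`. [folklore] -/
def GjJ : Language Bool := pairFn (asFn ∘ fstP) (sndP ∘ fstP) ⁻¹' LenLt X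
/-- On `⟨⟨⟨x, as⟩, 1ʲ⟩, 1ʲ'⟩`: `j' < |as|`. [folklore] -/
def GjK : Language Bool := pairFn (asFn ∘ fstP) sndP ⁻¹' LenLt X
/-- On `⟨⟨⟨x, as⟩, 1ʲ⟩, 1ʲ'⟩`: the queries of rounds `j` and `j'` coincide. [folklore] -/
def EqQ : Language Bool := {u | (List.tail ∘ step1 M ∘ fstP) u = (List.tail ∘ stepK M) u}
/-- On `⟨⟨⟨x, as⟩, 1ʲ⟩, 1ʲ'⟩`: `as_j = 1`. [folklore] -/
def BTJ : Language Bool := (suf1 ∘ fstP) ⁻¹' HeadIs true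
/-- On `⟨⟨⟨x, as⟩, 1ʲ⟩, 1ʲ'⟩`: `as_{j'} = 1`. [folklore] -/
def BTK : Language Bool := sufK ⁻¹' HeadIs true
/-- On `⟨⟨⟨x, as⟩, 1ʲ⟩, 1ʲ'⟩`: `as_j = 1 ↔ as_{j'} = 1`. [folklore] -/
def Same : Language Bool := (BTJ ⊓ BTK) ⊔ ((BTJ)ᶜ ⊓ (BTK)ᶜ)
/-- Body of (W4), consistency: if `j, j' < |as|` and `y_j = y_{j'}` then `as_j = as_{j'}`.
[cite: Goldreich2006, §1.2 Def. 3 (functions σ)] -/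
def bodyS : Language Bool := (GjJ)ᶜ ⊔ ((GjK)ᶜ ⊔ ((EqQ M)ᶜ ⊔ Same))
/-- (W1) on `⟨x, as⟩`: the step after all guessed answers outputs `v`. [folklore] -/
def FinL (v : Bool) : Language Bool :=
  (last0 M ⁻¹' HeadIs true) ⊓ ((List.tail ∘ last0 M) ⁻¹' HeadIs v)

/-- **The witness language** of the NP-verifier simulating the Cook reduction with guessed,
certified, consistent answers: (W1) ⊓ (W2) ⊓ (W4) ⊓ (W3) of the module docstring.
[cite: AharonovRegev2005, Lemma B.1 (proof, p. 15)] -/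
def certLang (v : Bool) : Language Bool :=
  (LenLt q ⊓ FinL M v ⊓ ballLang X (bodyQ M) ⊓ ballLang X (ballLang X (bodyS M))) ⊓
    ballLang X (bodyC M A B)

variable {M}

/-- `Gj1 ∈ P`. [folklore] -/
theorem Gj1_mem_P : Gj1 ∈ Classes.P :=
  preimage_mem_P (LenLt_mem_P X) (pairFn_mem_FP asFn_mem_FP sndP_mem_FP)

/-- `IQ1 M ∈ P`. [folklore] -/
theorem IQ1_mem_P (hM : M.IsPolyTime encodingBoolBool) : IQ1 M ∈ Classes.P :=
  preimage_mem_P (HeadIs_mem_P false) (step1_mem_FP hM)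

/-- `BT1 ∈ P`. [folklore] -/
theorem BT1_mem_P : BT1 ∈ Classes.P :=
  preimage_mem_P (HeadIs_mem_P true) suf1_mem_FP

/-- `QIn M C ∈ NP` for `C ∈ NP` (closure of `NP` under `FP` preimages). [cite: AroraBarak2009, Thm. 2.8] -/
theorem QIn_mem_NP (hM : M.IsPolyTime encodingBoolBool) {C : Language Bool}
    (hC : C ∈ Nondeterministic.NP) : QIn M C ∈ Nondeterministic.NP :=
  preimage_mem_NP hC (comp_mem_FP tail_mem_FP (step1_mem_FP hM))

/-- `bodyQ M ∈ P`. [folklore] -/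
theorem bodyQ_mem_P (hM : M.IsPolyTime encodingBoolBool) : bodyQ M ∈ Classes.P :=
  union_mem_P (compl_mem_P_iff.2 Gj1_mem_P) (IQ1_mem_P hM)

/-- `bodyC M A B ∈ NP` for `A, B ∈ NP` (union with a `P` language and a `P`-guarded case split of
two `NP` languages). [cite: AroraBarak2009, Thm. 2.8] -/
theorem bodyC_mem_NP (hM : M.IsPolyTime encodingBoolBool) (hA : A ∈ Nondeterministic.NP)
    (hB : B ∈ Nondeterministic.NP) : bodyC M A B ∈ Nondeterministic.NP :=
  union_P_mem_polyExists (K := Classes.P) (fun _ _ h₁ h₂ => union_mem_P h₁ h₂)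
    (compl_mem_P_iff.2 Gj1_mem_P)
    (caseSplit_mem_polyExists (K := Classes.P) (fun _ _ h₁ h₂ => inter_mem_P h₁ h₂)
      (fun _ _ _ hS h₁ h₂ => caseSplit_mem_P hS h₁ h₂) BT1_mem_P (QIn_mem_NP hM hA)
      (QIn_mem_NP hM hB))

/-- `GjJ ∈ P`. [folklore] -/
theorem GjJ_mem_P : GjJ ∈ Classes.P :=
  preimage_mem_P (LenLt_mem_P X)
    (pairFn_mem_FP (comp_mem_FP asFn_mem_FP fstP_mem_FP) (comp_mem_FP sndP_mem_FP fstP_mem_FP))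

/-- `GjK ∈ P`. [folklore] -/
theorem GjK_mem_P : GjK ∈ Classes.P :=
  preimage_mem_P (LenLt_mem_P X) (pairFn_mem_FP (comp_mem_FP asFn_mem_FP fstP_mem_FP) sndP_mem_FP)

/-- `EqQ M ∈ P` (the string-equality test of `StringEquality.lean`). [folklore] -/
theorem EqQ_mem_P (hM : M.IsPolyTime encodingBoolBool) : EqQ M ∈ Classes.P :=
  setOf_apply_eq_apply_mem_P (comp_mem_FP tail_mem_FP (comp_mem_FP (step1_mem_FP hM) fstP_mem_FP))
    (comp_mem_FP tail_mem_FP (stepK_mem_FP hM))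

/-- `BTJ ∈ P`. [folklore] -/
theorem BTJ_mem_P : BTJ ∈ Classes.P :=
  preimage_mem_P (HeadIs_mem_P true) (comp_mem_FP suf1_mem_FP fstP_mem_FP)

/-- `BTK ∈ P`. [folklore] -/
theorem BTK_mem_P : BTK ∈ Classes.P :=
  preimage_mem_P (HeadIs_mem_P true) sufK_mem_FP

/-- `Same ∈ P`. [folklore] -/
theorem Same_mem_P : Same ∈ Classes.P :=
  union_mem_P (inter_mem_P BTJ_mem_P BTK_mem_P)
    (inter_mem_P (compl_mem_P_iff.2 BTJ_mem_P) (compl_mem_P_iff.2 BTK_mem_P))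

/-- `bodyS M ∈ P`. [folklore] -/
theorem bodyS_mem_P (hM : M.IsPolyTime encodingBoolBool) : bodyS M ∈ Classes.P :=
  union_mem_P (compl_mem_P_iff.2 GjJ_mem_P) (union_mem_P (compl_mem_P_iff.2 GjK_mem_P)
    (union_mem_P (compl_mem_P_iff.2 (EqQ_mem_P hM)) Same_mem_P))

/-- `FinL M v ∈ P`. [folklore] -/
theorem FinL_mem_P (hM : M.IsPolyTime encodingBoolBool) (v : Bool) : FinL M v ∈ Classes.P :=
  inter_mem_P (preimage_mem_P (HeadIs_mem_P true) (last0_mem_FP hM))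
    (preimage_mem_P (HeadIs_mem_P v) (comp_mem_FP tail_mem_FP (last0_mem_FP hM)))

/-- **The witness language is in `NP`** for polynomial-time `M` and `A, B ∈ NP`: (W1), (W2), (W4)
are `P` languages (bounded loops over `P` bodies, `ballLang_mem_P`), (W3) is a bounded loop over an
`NP` body (`NPBounded.ballLang_mem_NP`), and `NP` absorbs intersections with `P` languages.
[cite: AharonovRegev2005, Lemma B.1 (proof, p. 15)] -/
theorem certLang_mem_NP (hM : M.IsPolyTime encodingBoolBool) (hA : A ∈ Nondeterministic.NP)
    (hB : B ∈ Nondeterministic.NP) (v : Bool) : certLang M A B q v ∈ Nondeterministic.NP :=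
  inter_P_mem_polyExists (K := Classes.P) (fun _ _ h₁ h₂ => inter_mem_P h₁ h₂)
    (inter_mem_P (inter_mem_P (inter_mem_P (LenLt_mem_P q) (FinL_mem_P hM v))
      (ballLang_mem_P X (bodyQ_mem_P hM))) (ballLang_mem_P X (ballLang_mem_P X (bodyS_mem_P hM))))
    (NPBounded.ballLang_mem_NP X (bodyC_mem_NP A B hM hA hB))

end Languages

/-! ### Reading the witness language -/

section Reading

variable (M : OracleAlg Bool) (A B : Language Bool) (q : Polynomial ℕ) (x as : List Bool) (j j' : ℕ)

/-- Reading `Gj1`: `j < |as|`. [folklore] -/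
theorem mem_Gj1_iff : boolPair (boolPair x as) (List.replicate j true) ∈ Gj1 ↔ j < as.length := by
  change pairFn asFn sndP (boolPair (boolPair x as) (List.replicate j true)) ∈ LenLt X ↔ _
  simp only [pairFn_apply, asFn_apply, sndP_boolPair, boolPair_mem_LenLt, eval_X, List.length_replicate]

/-- Reading `IQ1`: round `j` is a query. [folklore] -/
theorem mem_IQ1_iff : boolPair (boolPair x as) (List.replicate j true) ∈ IQ1 M ↔
    ∃ y, M.step x (bitsTrans (as.take j)) = Sum.inl y := by
  change step1 M (boolPair (boolPair x as) (List.replicate j true)) ∈ HeadIs false ↔ _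
  rw [step1_apply, List.length_replicate, stepCode_mem_HeadIs_false_iff]

/-- Reading `BT1`: `as_j = 1`. [folklore] -/
theorem mem_BT1_iff : boolPair (boolPair x as) (List.replicate j true) ∈ BT1 ↔
    (as.drop j).head? = some true := by
  change suf1 (boolPair (boolPair x as) (List.replicate j true)) ∈ HeadIs true ↔ _
  rw [suf1_apply, List.length_replicate, mem_HeadIs]

/-- Reading `QIn`: the query of round `j` is in `C`. [folklore] -/
theorem mem_QIn_iff (C : Language Bool) : boolPair (boolPair x as) (List.replicate j true) ∈ QIn M C ↔
    qryAt M x as j ∈ C := by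
  change (step1 M (boolPair (boolPair x as) (List.replicate j true))).tail ∈ C ↔ _
  rw [step1_apply, List.length_replicate]
  rfl

/-- Reading the body of (W2). [folklore] -/
theorem mem_bodyQ_iff : boolPair (boolPair x as) (List.replicate j true) ∈ bodyQ M ↔
    (j < as.length → ∃ y, M.step x (bitsTrans (as.take j)) = Sum.inl y) := by
  change (¬ _ ∈ Gj1) ∨ _ ∈ IQ1 M ↔ _
  rw [mem_Gj1_iff, mem_IQ1_iff]
  exact imp_iff_not_or.symm

/-- Reading the body of (W3). [folklore] -/
theorem mem_bodyC_iff : boolPair (boolPair x as) (List.replicate j true) ∈ bodyC M A B ↔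
    (j < as.length → ((as.drop j).head? = some true → qryAt M x as j ∈ A) ∧
      ((as.drop j).head? ≠ some true → qryAt M x as j ∈ B)) := by
  change (¬ _ ∈ Gj1) ∨ _ ∈ caseSplit BT1 (QIn M A) (QIn M B) ↔ _
  rw [mem_Gj1_iff, mem_caseSplit_iff, mem_BT1_iff, mem_QIn_iff, mem_QIn_iff]
  exact imp_iff_not_or.symm

/-- Reading `GjJ`: `j < |as|`. [folklore] -/
theorem mem_GjJ_iff : boolPair (boolPair (boolPair x as) (List.replicate j true)) (List.replicate j' true) ∈
    GjJ ↔ j < as.length := by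
  change pairFn (asFn ∘ fstP) (sndP ∘ fstP)
    (boolPair (boolPair (boolPair x as) (List.replicate j true)) (List.replicate j' true)) ∈ LenLt X ↔ _
  simp only [pairFn_apply, Function.comp_apply, fstP_boolPair, asFn_apply, sndP_boolPair,
    boolPair_mem_LenLt, eval_X, List.length_replicate]

/-- Reading `GjK`: `j' < |as|`. [folklore] -/
theorem mem_GjK_iff : boolPair (boolPair (boolPair x as) (List.replicate j true)) (List.replicate j' true) ∈
    GjK ↔ j' < as.length := by
  change pairFn (asFn ∘ fstP) sndP
    (boolPair (boolPair (boolPair x as) (List.replicate j true)) (List.replicate j' true)) ∈ LenLt X ↔ _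
  simp only [pairFn_apply, Function.comp_apply, fstP_boolPair, asFn_apply, sndP_boolPair,
    boolPair_mem_LenLt, eval_X, List.length_replicate]

/-- Reading `EqQ`: the queries of rounds `j`, `j'` coincide. [folklore] -/
theorem mem_EqQ_iff : boolPair (boolPair (boolPair x as) (List.replicate j true)) (List.replicate j' true) ∈
    EqQ M ↔ qryAt M x as j = qryAt M x as j' := by
  change (List.tail ∘ step1 M ∘ fstP) (boolPair (boolPair (boolPair x as) (List.replicate j true)) (List.replicate j' true)) =
    (List.tail ∘ stepK M) (boolPair (boolPair (boolPair x as) (List.replicate j true)) (List.replicate j' true)) ↔ _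
  simp only [Function.comp_apply, fstP_boolPair, step1_apply, stepK_apply, List.length_replicate]
  rfl

/-- Reading `BTJ`: `as_j = 1`. [folklore] -/
theorem mem_BTJ_iff : boolPair (boolPair (boolPair x as) (List.replicate j true)) (List.replicate j' true) ∈
    BTJ ↔ (as.drop j).head? = some true := by
  change (suf1 ∘ fstP) (boolPair (boolPair (boolPair x as) (List.replicate j true)) (List.replicate j' true)) ∈ HeadIs true ↔ _
  rw [Function.comp_apply, fstP_boolPair, suf1_apply, List.length_replicate, mem_HeadIs]

/-- Reading `BTK`: `as_{j'} = 1`. [folklore] -/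
theorem mem_BTK_iff : boolPair (boolPair (boolPair x as) (List.replicate j true)) (List.replicate j' true) ∈
    BTK ↔ (as.drop j').head? = some true := by
  change sufK (boolPair (boolPair (boolPair x as) (List.replicate j true)) (List.replicate j' true)) ∈ HeadIs true ↔ _
  rw [sufK_apply, List.length_replicate, mem_HeadIs]

/-- Reading `Same`: `as_j = 1 ↔ as_{j'} = 1`. [folklore] -/
theorem mem_Same_iff : boolPair (boolPair (boolPair x as) (List.replicate j true)) (List.replicate j' true) ∈
    Same ↔ ((as.drop j).head? = some true ↔ (as.drop j').head? = some true) := by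
  change (_ ∈ BTJ ∧ _ ∈ BTK) ∨ (¬ _ ∈ BTJ ∧ ¬ _ ∈ BTK) ↔ _
  rw [mem_BTJ_iff, mem_BTK_iff]
  tauto

/-- Reading the body of (W4). [folklore] -/
theorem mem_bodyS_iff : boolPair (boolPair (boolPair x as) (List.replicate j true)) (List.replicate j' true) ∈
    bodyS M ↔ (j < as.length → j' < as.length → qryAt M x as j = qryAt M x as j' →
      ((as.drop j).head? = some true ↔ (as.drop j').head? = some true)) := by
  change (¬ _ ∈ GjJ) ∨ ((¬ _ ∈ GjK) ∨ ((¬ _ ∈ EqQ M) ∨ _ ∈ Same)) ↔ _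
  rw [mem_GjJ_iff, mem_GjK_iff, mem_EqQ_iff, mem_Same_iff]
  tauto

/-- Reading (W1): the step after all of `as` outputs `v`. [folklore] -/
theorem mem_FinL_iff (v : Bool) : boolPair x as ∈ FinL M v ↔ M.step x (bitsTrans as) = Sum.inr v := by
  change last0 M (boolPair x as) ∈ HeadIs true ∧ (last0 M (boolPair x as)).tail ∈ HeadIs v ↔ _
  rw [last0_apply, stepCode_output_iff]

/-- Reading (W2): every round `j < |as|` is a query. [folklore] -/
theorem mem_ballLang_bodyQ_iff : boolPair x as ∈ ballLang X (bodyQ M) ↔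
    ∀ j < as.length, ∃ y, M.step x (bitsTrans (as.take j)) = Sum.inl y := by
  simp only [mem_ballLang, eval_X, mem_bodyQ_iff]
  constructor
  · intro h j hj
    exact h j (by rw [length_boolPair]; omega) hj
  · intro h j _ hj
    exact h j hj

/-- Reading (W3): the guessed bits are certified. [cite: AharonovRegev2005, Lemma B.1 (proof, p. 15)] -/
theorem mem_ballLang_bodyC_iff : boolPair x as ∈ ballLang X (bodyC M A B) ↔
    ∀ j < as.length, ((as.drop j).head? = some true → qryAt M x as j ∈ A) ∧
      ((as.drop j).head? ≠ some true → qryAt M x as j ∈ B) := by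
  simp only [mem_ballLang, eval_X, mem_bodyC_iff]
  constructor
  · intro h j hj
    exact h j (by rw [length_boolPair]; omega) hj
  · intro h j _ hj
    exact h j hj

/-- Reading (W4): equal queries carry equal guessed bits. [cite: Goldreich2006, §1.2 Def. 3 (functions σ)] -/
theorem mem_ballLang_bodyS_iff : boolPair x as ∈ ballLang X (ballLang X (bodyS M)) ↔
    ∀ j < as.length, ∀ j' < as.length, qryAt M x as j = qryAt M x as j' →
      ((as.drop j).head? = some true ↔ (as.drop j').head? = some true) := by
  simp only [mem_ballLang, eval_X, mem_bodyS_iff]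
  constructor
  · intro h j hj j' hj'
    exact h j (by rw [length_boolPair]; omega) j'
      (by rw [length_boolPair, length_boolPair, List.length_replicate]; omega) hj hj'
  · intro h j _ j' _ hj hj'
    exact h j hj j' hj'

/-- **Reading the witness language.** [cite: AharonovRegev2005, Lemma B.1 (proof, p. 15)] -/
theorem mem_certLang_iff (v : Bool) : boolPair x as ∈ certLang M A B q v ↔
    (as.length < q.eval x.length ∧ M.step x (bitsTrans as) = Sum.inr v) ∧
    (∀ j < as.length, ∃ y, M.step x (bitsTrans (as.take j)) = Sum.inl y) ∧
    (∀ j < as.length, ∀ j' < as.length, qryAt M x as j = qryAt M x as j' →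
      ((as.drop j).head? = some true ↔ (as.drop j').head? = some true)) ∧
    (∀ j < as.length, ((as.drop j).head? = some true → qryAt M x as j ∈ A) ∧
      ((as.drop j).head? ≠ some true → qryAt M x as j ∈ B)) := by
  change (((boolPair x as ∈ LenLt q ∧ _ ∈ FinL M v) ∧ _ ∈ ballLang X (bodyQ M)) ∧
    _ ∈ ballLang X (ballLang X (bodyS M))) ∧ _ ∈ ballLang X (bodyC M A B) ↔ _
  rw [boolPair_mem_LenLt, mem_FinL_iff, mem_ballLang_bodyQ_iff, mem_ballLang_bodyS_iff,
    mem_ballLang_bodyC_iff]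
  simp only [and_assoc]

end Reading

/-! ### Correctness -/

section Correctness

variable {M : OracleAlg Bool} {A B : Language Bool} {q : Polynomial ℕ}

open Classical in
/-- **The oracle of a consistent guess**: on a string queried at some round `j < |as|` of the
guessed run answer the guessed bit `as_j` (well defined up to the choice of `j` by (W4)); elsewhere
answer `[y ∈ A]`. [cite: Goldreich2006, §1.2 Def. 3 (functions σ)] -/
def guessOracle (M : OracleAlg Bool) (A : Language Bool) (x as : List Bool) : Oracle := fun y =>
  if h : ∃ j, j < as.length ∧ qryAt M x as j = y then [as.getD (Classical.choose h) false]
  else [A.boolIndicator y]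

/-- The guess oracle on a queried string. [folklore] -/
theorem guessOracle_of_exists {x as y : List Bool} (h : ∃ j, j < as.length ∧ qryAt M x as j = y) :
    guessOracle M A x as y = [as.getD (Classical.choose h) false] := by
  unfold guessOracle
  rw [dif_pos h]

/-- The guess oracle off the queried strings. [folklore] -/
theorem guessOracle_of_not_exists {x as y : List Bool} (h : ¬ ∃ j, j < as.length ∧ qryAt M x as j = y) :
    guessOracle M A x as y = [A.boolIndicator y] := by
  unfold guessOracle
  rw [dif_neg h]

/-- **Soundness.** If `⟨x, as⟩` is in the witness language then the guess oracle is certified, the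
run of `M` against it follows the guessed answers and outputs `v`; since `M` outputs `b x` against
every certified oracle, `b x = v` ("`T` receives the correct answers for all of its queries inside
`Π_NO ∪ Π_YES` and must therefore output the correct answer").
[cite: AharonovRegev2005, Lemma B.1 (proof, p. 15: soundness)] -/
theorem eq_of_mem_certLang (hAB : ∀ y, y ∉ A → y ∈ B) {b : List Bool → Bool}
    (hrun : ∀ O : Oracle, Certified A B O → ∀ x, M.run O (q.eval x.length) x = some (b x))
    {v : Bool} {x as : List Bool} (hmem : boolPair x as ∈ certLang M A B q v) : b x = v := by
  obtain ⟨⟨hlen, hfin⟩, hQ, hS, hC⟩ := (mem_certLang_iff M A B q x as v).1 hmem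
  set O : Oracle := guessOracle M A x as with hO
  -- (W4): the guessed bit of a query does not depend on the round at which it is asked
  have hbit : ∀ {j j' : ℕ}, j < as.length → j' < as.length → qryAt M x as j = qryAt M x as j' →
      as.getD j false = as.getD j' false := by
    intro j j' hj hj' he
    have h := hS j hj j' hj' he
    rw [head?_drop_eq_some_getD as hj, head?_drop_eq_some_getD as hj', Option.some.injEq,
      Option.some.injEq] at h
    exact Bool.eq_iff_iff.2 h
  have hOq : ∀ {j : ℕ}, j < as.length → O (qryAt M x as j) = [as.getD j false] := by
    intro j hj
    have hex : ∃ j', j' < as.length ∧ qryAt M x as j' = qryAt M x as j := ⟨j, hj, rfl⟩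
    rw [hO, guessOracle_of_exists hex]
    obtain ⟨hj', he⟩ := Classical.choose_spec hex
    rw [hbit hj' hj he]
  -- (W2): the guessed run is a run of `M` against `O`
  have hvalid : ∀ i < as.length, ∃ y, M.step x (bitsTrans (as.take i)) = Sum.inl y ∧
      O y = [as.getD i false] := by
    intro i hi
    obtain ⟨y, hy⟩ := hQ i hi
    exact ⟨y, hy, by rw [← qryAt_eq_of_step_eq hy]; exact hOq hi⟩
  have htr : ∀ i ≤ as.length, trans M O x i = bitsTrans (as.take i) :=
    trans_eq_bitsTrans_take_of_answers M O x as as.length le_rfl hvalid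
  -- (W1): it outputs `v`
  have hrunO : M.run O (q.eval x.length) x = some v := by
    rw [run_eq_some_iff]
    refine ⟨as.length, hlen, fun i hi => ?_, ?_⟩
    · obtain ⟨y, hy, -⟩ := hvalid i hi
      exact ⟨y, by rw [htr i hi.le]; exact hy⟩
    · rw [htr as.length le_rfl, List.take_length]
      exact hfin
  -- (W3): `O` is certified
  have hcert : Certified A B O := by
    intro y
    by_cases hex : ∃ j, j < as.length ∧ qryAt M x as j = y
    · obtain ⟨hj, he⟩ := Classical.choose_spec hex
      have hOy : O y = [as.getD (Classical.choose hex) false] := by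
        rw [hO, guessOracle_of_exists hex]
      have hCj := hC _ hj
      rw [head?_drop_eq_some_getD as hj, he] at hCj
      cases hb : as.getD (Classical.choose hex) false
      · refine Or.inr ⟨by rw [hOy, hb], hCj.2 ?_⟩
        rw [hb]
        simp
      · exact Or.inl ⟨by rw [hOy, hb], hCj.1 (by rw [hb])⟩
    · have hOy : O y = [A.boolIndicator y] := by rw [hO, guessOracle_of_not_exists hex]
      by_cases hyA : y ∈ A
      · exact Or.inl ⟨by rw [hOy, (Set.mem_iff_boolIndicator _ _).1 hyA], hyA⟩
      · exact Or.inr ⟨by rw [hOy, (Set.notMem_iff_boolIndicator _ _).1 hyA], hAB y hyA⟩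
  have h := hrun O hcert x
  rw [hrunO, Option.some.injEq] at h
  exact h.symm

/-- **Completeness.** If the run of `M` against the (certified) oracle of `A` outputs `v`, its true
answer bits `answerBits` lie in the witness language: every round before the output is a query,
the bit of the query `y` is `[y ∈ A]` (certified: `y ∈ A`, or `y ∉ A` hence `y ∈ B`), and equal
queries get equal bits. [cite: AharonovRegev2005, Lemma B.1 (proof, p. 15: completeness)] -/
theorem mem_certLang_answerBits (hAB : ∀ y, y ∉ A → y ∈ B) {v : Bool} {x : List Bool}
    (hrun : M.run (Oracle.ofLanguage A) (q.eval x.length) x = some v) :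
    ∃ as : List Bool, as.length ≤ q.eval x.length ∧ boolPair x as ∈ certLang M A B q v := by
  set O := Oracle.ofLanguage A with hO
  obtain ⟨m, hm, hsteps, hfin⟩ := (run_eq_some_iff M O _ x v).1 hrun
  refine ⟨answerBits M A x m, by rw [length_answerBits]; exact hm.le, ?_⟩
  have htr : ∀ i ≤ m, bitsTrans ((answerBits M A x m).take i) = trans M O x i := fun i hi => by
    rw [answerBits_take M A x hi, ← trans_eq_bitsTrans_answerBits]
  -- the query of round `j < m` and its answer bit
  have hq : ∀ j < m, ∃ y, M.step x (trans M O x j) = Sum.inl y ∧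
      qryAt M x (answerBits M A x m) j = y ∧
      ((answerBits M A x m).drop j).head? = some (A.boolIndicator y) := by
    intro j hj
    obtain ⟨y, hy⟩ := hsteps j hj
    refine ⟨y, hy, ?_, ?_⟩
    · apply qryAt_eq_of_step_eq
      rw [htr j hj.le]
      exact hy
    · rw [head?_drop_eq_some_getD _ (by rw [length_answerBits]; exact hj), answerBits_getD M A x hj,
        qryOf_eq_of_step_eq hy]
  rw [mem_certLang_iff, length_answerBits]
  refine ⟨⟨hm, ?_⟩, fun j hj => ?_, fun j hj j' hj' he => ?_, fun j hj => ?_⟩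
  · have h := htr m le_rfl
    rw [List.take_of_length_le (by rw [length_answerBits])] at h
    rw [h]
    exact hfin
  · obtain ⟨y, hy, -, -⟩ := hq j hj
    exact ⟨y, by rw [htr j hj.le]; exact hy⟩
  · obtain ⟨y, -, hqy, hby⟩ := hq j hj
    obtain ⟨y', -, hqy', hby'⟩ := hq j' hj'
    have hyy : y = y' := hqy.symm.trans (he.trans hqy')
    rw [hby, hby', hyy]
  · obtain ⟨y, -, hqy, hby⟩ := hq j hj
    rw [hby, hqy]
    refine ⟨fun h => ?_, fun h => hAB y fun hyA => h ?_⟩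
    · rw [Option.some.injEq] at h
      exact (Set.mem_iff_boolIndicator _ _).2 h
    · rw [(Set.mem_iff_boolIndicator _ _).1 hyA]

end Correctness

end PromiseCookNP

open PromiseCookNP

/-- **A polynomial-time oracle computation all of whose oracle answers are `NP`-certifiable is an
`NP` computation** (the content of Aharonov–Regev's proof of Lemma B.1, for an arbitrary oracle
algorithm). Let `A, B ∈ NP` with every string in `A` or in `B`, and let `M` (polynomial-time step
function, round budget `q`) output the bit `b x` on `x` against every oracle whose answers are all
certified (`[true]` only on strings of `A`, `[false]` only on strings of `B`). Then
`{x | b x = v} ∈ NP` for each bit `v` — guess the answers, verify the certificates, the consistency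
of repeated queries, and the replayed run. [cite: AharonovRegev2005, Lemma B.1 (proof, p. 15)] -/
theorem mem_NP_of_run_certified {A B : Language Bool} (hA : A ∈ Nondeterministic.NP)
    (hB : B ∈ Nondeterministic.NP) (hAB : ∀ y, y ∉ A → y ∈ B) {M : OracleAlg Bool}
    (hM : M.IsPolyTime encodingBoolBool) {q : Polynomial ℕ} {b : List Bool → Bool}
    (hrun : ∀ O : Oracle, Certified A B O → ∀ x, M.run O (q.eval x.length) x = some (b x))
    (v : Bool) : {x | b x = v} ∈ Nondeterministic.NP := by
  have hmem : {x | b x = v} ∈ polyExists Nondeterministic.NP := by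
    refine ⟨certLang M A B q v, certLang_mem_NP A B q hM hA hB v, q, fun x => ⟨fun hx => ?_, ?_⟩⟩
    · have hx' : b x = v := hx
      exact mem_certLang_answerBits hAB (by rw [hrun _ (certified_ofLanguage hAB) x, hx'])
    · rintro ⟨as, -, has⟩
      exact eq_of_mem_certLang hAB hrun has
  exact KarpLipton.polyExists_polyExists_subset (K := Classes.P) (fun _ hL _ hg => preimage_mem_P hL hg)
    (fun _ _ h₁ h₂ => inter_mem_P h₁ h₂) hmem

namespace PromiseProblem

/-- **Aharonov–Regev 2005, Lemma B.1 (one language).** If the language `L` Cook-reduces (as a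
promise problem with trivial promise, Goldreich's Def. 3) to a promise problem `Q` which is in
`PromiseCoNP` (a `coNP` language `L'` contains `Q.yes` and misses `Q.no`: the verifier `V₁`) and whose
non-promise version `(Q.yes ∪ Q.maybe, Q.no)`, i.e. the language `(Q.no)ᶜ`, is in `NP` (the verifier
`V₂`), then `L ∈ NP ∩ coNP`: with `A := (Q.no)ᶜ`, `B := L'ᶜ` every certified oracle solves `Q`, so
the reduction outputs `[x ∈ L]` against it, and `mem_NP_of_run_certified` applies to both output
bits. [cite: AharonovRegev2005, Lemma B.1 (p. 15)] -/
theorem mem_NP_inter_coNP_of_cookReducible {L : Language Bool} {Q : PromiseProblem}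
    (h : (ofLanguage L).CookReducible Q) (hQ : Q ∈ PromiseCoNP)
    (hNP : (Q.no)ᶜ ∈ Nondeterministic.NP) : L ∈ Nondeterministic.NP ∩ coNP := by
  obtain ⟨M, hM, q, hred⟩ := h
  obtain ⟨L', hL', hyes, hno⟩ := hQ
  have hB : L'ᶜ ∈ Nondeterministic.NP := hL'
  have hAB : ∀ y, y ∉ (Q.no)ᶜ → y ∈ L'ᶜ := fun y hy hyL' => hy fun hyno => hno hyno hyL'
  have hsolve : ∀ O : Oracle, Certified (Q.no)ᶜ L'ᶜ O → Q.SolvedBy O := by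
    intro O hO
    refine ⟨fun y => ?_, fun y hy => ?_, fun y hy => ?_⟩
    · rcases hO y with ⟨h, -⟩ | ⟨h, -⟩ <;> simp [h]
    · rcases hO y with ⟨h, -⟩ | ⟨-, hB'⟩
      · exact h
      · exact absurd (hyes hy) hB'
    · rcases hO y with ⟨-, hA'⟩ | ⟨h, -⟩
      · exact absurd hy hA'
      · exact h
  have hrun : ∀ O : Oracle, Certified (Q.no)ᶜ L'ᶜ O → ∀ x,
      M.run O (q.eval x.length) x = some (L.boolIndicator x) := by
    intro O hO x
    have hx := hred O (hsolve O hO) x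
    by_cases hxL : x ∈ L
    · rw [(hx.1 hxL).1, (Set.mem_iff_boolIndicator _ _).1 hxL]
    · rw [(hx.2 hxL).1, (Set.notMem_iff_boolIndicator _ _).1 hxL]
  constructor
  · have h := mem_NP_of_run_certified hNP hB hAB hM hrun true
    have e : {x | L.boolIndicator x = true} = L := Set.ext fun x => (Set.mem_iff_boolIndicator _ _).symm
    rwa [e] at h
  · have h := mem_NP_of_run_certified hNP hB hAB hM hrun false
    have e : {x | L.boolIndicator x = false} = Lᶜ :=
      Set.ext fun x => (Set.notMem_iff_boolIndicator _ _).symm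
    rw [e] at h
    exact h

end PromiseProblem

end Literature.Computability.Complexity

end
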